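import Summits.Ventures.YMGap.FlowData.RectTubeMassGapPrimePos
import Summits.Ventures.YMGap.FlowData.SU2SignedCharacterChain
import Summits.Ventures.YMGap.FlowData.RectTubeTorelonEnvelope
import HarnessLib

/-!
# Venture YMGap, track Y3 FLOW-DATA — the PLAQUETTE (glueball) witness: on every rectangular `SU(2)` tube with two
# sides `Ls μ, Ls ν ≥ 2` the `e = 0` gap obeys `m′(β) ≤ 4·(−ln u(β)) + 2β·#P + ln 2` (theorems only)

HONEST FRAMING: venture file of the cell `pub-ymgap` (QuantumFields programme), track Y3; companion THEOREMS for
`FlowData/RectTubeVacuumProjection.lean` (`su2RectMassGapPrime` = the FLOW-TABLE's `m′`, FLOW-PLAN O5).  Finite rectangular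
torus only; no number of the FLOW-TABLE, no row, nothing about `L → ∞`, the continuum, or a mass gap in the thermodynamic
sense.  `4(−ln u(β))` is the strong-coupling GLUEBALL scale (one spatial plaquette, four links each costing `u`); the bound
is a CONSISTENCY ceiling (up to `2β#P + ln 2`), much tighter than the adjoint-torelon ceiling `(Ls μ)(−ln(I₃/I₁))` of
`RectTubeMassGapPrimeWindow` as soon as `Ls μ ≥ 3`.  No lower bound of this kind is claimed.

THE WITNESSES.  `f₁ = e^{−J mag/2}` and `f₂ = e^{−J mag/2} · U₁(a₀(plaq₀ b))`, the fundamental character of ONE spatial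
plaquette `plaq₀ b = b_{0,μ} b_{ê_μ,ν} b_{ê_ν,μ}⁻¹ b_{0,ν}⁻¹`: gauge invariant (a closed loop), twist invariant (a contractible
loop crosses each seam twice or not at all), hence in the trivial-flux sector; under `b ↦ c·b` the two backward links carry
`c⁻¹`, and the SIGNED character chain (`SU2SignedCharacterChain`) reproduces it with the factor `c₀^{N−4} (c₁/2)^4`
(`c₁/2 = 2I₂/β`, `c₀ = 2I₁/β`, ratio `u = I₂/I₁`); `∫ U₁(a₀(plaq₀)) = 0` kills the cross term.  The two-state bound of
`RectTubeMassGapPrime` gives `½ e^{−β#P} c₀^{N−4}(c₁/2)^4 ≤ ‖T ∘ (P_0 − P_Ω)‖`, and `‖T‖ ≤ e^{β#P} c₀^N`.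

* (plaquette bookkeeping — gauge conjugation, twist blindness, four distinct links — is in `SU2SignedCharacterChain`);
* **`su2_rectExcitedNorm_ge_plaquette`** — `½ e^{−β#P} c₀(β)^{N−4} (c₁(β)/2)^4 ≤ su2RectExcitedNorm β Ls`;
* **`su2RectMassGapPrime_le_plaquette`** — `su2RectMassGapPrime β Ls ≤ 4·(−log(I₂(β)/I₁(β))) + 2β·(#sites·k(k−1)/2) + log 2`;
* `su2RectMassGapPrime_le_plaquette'` — the same with `su2CharacterRatio β` (the table's `u`).

References: G. Münster, Nucl. Phys. B 190 (1981) 439 (strong-coupling glueball mass `4|ln u|`) [folklore]; I. Montvay,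
G. Münster (1994) §3.2.6 [cite: MontvayMunster1994, §3.2.6]; M. Reed, B. Simon IV (1978) §XIII.12 [cite: ReedSimonIV1978, §XIII.12].
-/

noncomputable section

open scoped BigOperators ENNReal
open MeasureTheory Filter Function Polynomial.Chebyshev
open Literature.MathematicalPhysics.QuantumFieldTheory Literature.Analysis.OperatorTheory Literature.Analysis.FunctionSpaces
open Literature.MathematicalPhysics.QuantumLattice (RectTorusSite fundamentalRep continuous_fundamentalRep
  fundamentalRep_mem_unitaryGroup)
open Literature.Barriers.QuantumFields
open Summit.Ventures.LatticeQCDFlow.Exactness Summit.Ventures.LatticeQCDFlow.Scoring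
open Summit.Ventures.YMGap.Conjectures (su2CharacterRatio)

namespace Summit.Ventures.YMGap.FlowData

/-! ### The plaquette witness and the glueball ceiling for `m′` -/

section SU2

variable {k : ℕ}

set_option maxHeartbeats 400000 in
/-- **`½ e^{−β#P} c₀^{N−4} (c₁/2)^4 ≤ ‖T ∘ (P_0 − P_Ω)‖`** on the `SU(2)` tube with sides `Ls μ, Ls ν ≥ 2` (`μ ≠ ν`), every
`β > 0` (`c₀ = (I₀−I₂)(β)`, `c₁/2 = (I₁−I₃)(β)/2`): the two-state bound with the vacuum direction and ONE PLAQUETTE.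
[cite: MontvayMunster1994, §3.2.6] -/
theorem su2_rectExcitedNorm_ge_plaquette {β : ℝ} (hβ : 0 < β) (Ls : Fin k → ℕ) [∀ i, NeZero (Ls i)] {μ ν : Fin k}
    (hμν : μ ≠ ν) (hμ : 2 ≤ Ls μ) (hν : 2 ≤ Ls ν) :
    Real.exp (-(β * (Fintype.card (RectTorusSite Ls) * Fintype.card {p : Fin k × Fin k // p.1 < p.2}))) *
        (((besselI 0 β - besselI (0 + 2) β) / ((0 : ℕ) + 1)) ^ (Fintype.card (RectTorusSite Ls × Fin k) - 4) *
          ((besselI 1 β - besselI (1 + 2) β) / ((1 : ℕ) + 1)) ^ 4) / 2 ≤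
      su2RectExcitedNorm β Ls := by
  haveI : SecondCountableTopology (Matrix.specialUnitaryGroup (Fin 2) ℂ) := secondCountableTopology_su2
  classical
  set ρ := fundamentalRep (Fin 2) with hρdef
  set J : ℝ := β / 2 with hJ
  set P : ℝ := (Fintype.card (RectTorusSite Ls) : ℝ) * (Fintype.card {p : Fin k × Fin k // p.1 < p.2} : ℝ) with hP
  set N : ℕ := Fintype.card (RectTorusSite Ls × Fin k) with hN
  set c0 : ℝ := (besselI 0 β - besselI (0 + 2) β) / ((0 : ℕ) + 1) with hc0
  set q2 : ℝ := (besselI 1 β - besselI (1 + 2) β) / ((1 : ℕ) + 1) with hq2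
  set C2 : ℝ := c0 ^ (N - 4) * q2 ^ 4 with hC2
  -- the vacuum package
  obtain ⟨φ₀, h1, hpos, -, hinv, -, hvac, -⟩ := exists_rectVacuum_gap ρ J (Ls := Ls)
    (continuous_fundamentalRep (Fin 2)) fundamentalRep_mem_unitaryGroup su2MinusOne_mem_center
  -- the plaquette, the two functions
  set x0 : RectTorusSite Ls := 0 with hx0
  set plaq : RectSlice Ls (Matrix.specialUnitaryGroup (Fin 2) ℂ) → Matrix.specialUnitaryGroup (Fin 2) ℂ :=
    fun b => b (x0, μ) * b (x0 + Pi.single μ 1, ν) * (b (x0 + Pi.single ν 1, μ))⁻¹ * (b (x0, ν))⁻¹ with hplaq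
  set ℓ : Fin 4 → RectTorusSite Ls × Fin k := ![(x0, μ), (x0 + Pi.single μ 1, ν), (x0 + Pi.single ν 1, μ), (x0, ν)] with hℓ
  set sg : Fin 4 → ℤ := ![1, 1, -1, -1] with hsg
  have hsg1 : ∀ t, sg t = 1 ∨ sg t = -1 := by
    intro t; fin_cases t <;> simp [hsg]
  have hℓinj : Injective ℓ := rectPlaquetteLinks_injective (Ls := Ls) hμν hμ hν x0
  set W2 : RectSlice Ls (Matrix.specialUnitaryGroup (Fin 2) ℂ) → ℝ :=
    fun b => (U ℝ ((1 : ℕ) : ℤ)).eval (su2a0 (plaq b)) with hW2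
  set m0 : RectSlice Ls (Matrix.specialUnitaryGroup (Fin 2) ℂ) → ℝ :=
    fun b => Real.exp (-(J / 2 * rectMagSum (Ls := Ls) ρ b)) with hm0
  have hce : ∀ e : RectTorusSite Ls × Fin k, Continuous fun b : RectSlice Ls (Matrix.specialUnitaryGroup (Fin 2) ℂ) => b e :=
    fun e => continuous_apply e
  have hplaqc : Continuous plaq := (((hce _).mul (hce _)).mul (hce _).inv).mul (hce _).inv
  have hW2c : Continuous W2 := (U ℝ ((1 : ℕ) : ℤ)).continuous.comp (continuous_su2a0.comp hplaqc)
  have hIpos : ∀ n : ℕ, 0 < besselI n β := fun n => by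
    rw [besselI_eq_latticeModels_besselI]; exact Literature.Probability.LatticeModels.besselI_pos hβ _
  have hm0c : Continuous m0 :=
    Real.continuous_exp.comp (continuous_const.mul (continuous_rectMagSum (Ls := Ls) ρ (continuous_fundamentalRep (Fin 2)))).neg
  have hf1c : Continuous fun b => m0 b * (1 : ℝ) := hm0c.mul continuous_const
  have hf2c : Continuous fun b => m0 b * W2 b := hm0c.mul hW2c
  obtain ⟨K1, hK1⟩ := isCompact_univ.exists_bound_of_continuousOn hf1c.continuousOn
  obtain ⟨K2, hK2⟩ := isCompact_univ.exists_bound_of_continuousOn hf2c.continuousOn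
  have hmem1 : MemLp (fun b => m0 b * (fun _ => (1 : ℝ)) b) 2 (rectSliceMeasure (Matrix.specialUnitaryGroup (Fin 2) ℂ) Ls) :=
    MemLp.of_bound hf1c.aestronglyMeasurable K1 (Eventually.of_forall fun b => hK1 b (Set.mem_univ _))
  have hmem2 : MemLp (fun b => m0 b * W2 b) 2 (rectSliceMeasure (Matrix.specialUnitaryGroup (Fin 2) ℂ) Ls) :=
    MemLp.of_bound hf2c.aestronglyMeasurable K2 (Eventually.of_forall fun b => hK2 b (Set.mem_univ _))
  -- the weight in the two normalisations
  have hw : ∀ c : RectSlice Ls (Matrix.specialUnitaryGroup (Fin 2) ℂ),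
      (∏ e : RectTorusSite Ls × Fin k, Real.exp (J * (ρ (c e)).trace.re)) =
        ∏ e : RectTorusSite Ls × Fin k, Real.exp (β * su2a0 (c e)) := fun c =>
    Finset.prod_congr rfl fun e _ => by rw [hρdef, su2_weight_eq, hJ]; ring_nf
  have hc0int : (∫ g, Real.exp (β * su2a0 g) ∂haarProbability (Matrix.specialUnitaryGroup (Fin 2) ℂ)) = c0 :=
    su2_integral_exp_su2a0_eq hβ.le
  -- gauge and twist invariance of `W2`
  have hW2g : ∀ (γ : RectTorusSite Ls → Matrix.specialUnitaryGroup (Fin 2) ℂ) (b : RectSlice Ls (Matrix.specialUnitaryGroup (Fin 2) ℂ)),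
      W2 (fun e => γ e.1 * b e * (γ (e.1 + Pi.single e.2 1))⁻¹) = W2 b := by
    intro γ b
    simp only [hW2, hplaq]
    rw [rectPlaquette_gauge γ b x0, mul_assoc, su2a0_mul_comm, inv_mul_cancel_right]
  have h1g : ∀ (γ : RectTorusSite Ls → Matrix.specialUnitaryGroup (Fin 2) ℂ) (b : RectSlice Ls (Matrix.specialUnitaryGroup (Fin 2) ℂ)),
      (fun _ : RectSlice Ls (Matrix.specialUnitaryGroup (Fin 2) ℂ) => (1 : ℝ))
        (fun e => γ e.1 * b e * (γ (e.1 + Pi.single e.2 1))⁻¹) = (fun _ => (1 : ℝ)) b := fun _ _ => rfl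
  have hW2s : ∀ (s : Fin k → ZMod 2) (b : RectSlice Ls (Matrix.specialUnitaryGroup (Fin 2) ℂ)),
      W2 (rectFluxTwist su2MinusOne s b) = W2 b := by
    intro s b
    simp only [hW2, hplaq]
    rw [rectPlaquette_fluxTwist su2MinusOne_mem_center s b x0 hμν]
  -- reproducing properties
  have hrep2 : ∀ a : RectSlice Ls (Matrix.specialUnitaryGroup (Fin 2) ℂ),
      ∫ c, (∏ e : RectTorusSite Ls × Fin k, Real.exp (J * (ρ (c e)).trace.re)) * W2 (c * a)
        ∂(rectSliceMeasure (Matrix.specialUnitaryGroup (Fin 2) ℂ) Ls) = C2 * W2 a := by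
    intro a
    simp_rw [hw]
    -- the plaquette of `c·a` as a signed chain in the four link variables
    set d : Fin 4 → Matrix.specialUnitaryGroup (Fin 2) ℂ :=
      ![a (x0, μ), a (x0 + Pi.single μ 1, ν) * (a (x0 + Pi.single ν 1, μ))⁻¹, (a (x0, ν))⁻¹, 1] with hd
    have h4 : ∀ c : RectSlice Ls (Matrix.specialUnitaryGroup (Fin 2) ℂ), W2 (c * a) =
        (U ℝ ((1 : ℕ) : ℤ)).eval (su2a0 ((List.ofFn fun t : Fin 4 => c (ℓ t) ^ sg t * d t).prod)) := by
      intro c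
      simp only [hW2, hplaq, hℓ, hsg, hd, Pi.mul_apply, List.ofFn_succ, List.ofFn_zero, List.prod_cons, List.prod_nil,
        Matrix.cons_val_zero, Matrix.cons_val_succ, zpow_one, zpow_neg, mul_inv_rev, mul_one, mul_assoc]
    have hd2 : (List.ofFn d).prod = plaq a := by
      simp only [hd, hplaq, List.ofFn_succ, List.ofFn_zero, List.prod_cons, List.prod_nil, Matrix.cons_val_zero,
        Matrix.cons_val_succ, mul_one, mul_assoc]
    simp_rw [h4]
    have h := su2_integral_prod_exp_mul_chebyshevU_rectSignedLine (Ls := Ls) hβ.le 1 ℓ hℓinj hsg1 d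
    rw [hc0int, hd2] at h
    rw [h]
  have hrep1 : ∀ a : RectSlice Ls (Matrix.specialUnitaryGroup (Fin 2) ℂ),
      ∫ c, (∏ e : RectTorusSite Ls × Fin k, Real.exp (J * (ρ (c e)).trace.re)) * (fun _ => (1 : ℝ)) (c * a)
        ∂(rectSliceMeasure (Matrix.specialUnitaryGroup (Fin 2) ℂ) Ls) = c0 ^ N * (fun _ => (1 : ℝ)) a := by
    intro a
    simp_rw [hw, mul_one]
    rw [show rectSliceMeasure (Matrix.specialUnitaryGroup (Fin 2) ℂ) Ls =
      Measure.pi (fun _ : RectTorusSite Ls × Fin k => haarProbability (Matrix.specialUnitaryGroup (Fin 2) ℂ)) from rfl,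
      integral_fintype_prod_eq_prod (fun (_ : RectTorusSite Ls × Fin k) (g : Matrix.specialUnitaryGroup (Fin 2) ℂ) =>
        Real.exp (β * su2a0 g)), Finset.prod_const, Finset.card_univ, hc0int]
  -- matrix elements
  have hA1 := inner_rectTubeTransferOperator_reproducingState_left ρ J (Ls := Ls) (continuous_fundamentalRep (Fin 2))
    continuous_const h1g hrep1 hmem1 hmem1
  have hA2 := inner_rectTubeTransferOperator_reproducingState_left ρ J (Ls := Ls) (continuous_fundamentalRep (Fin 2))
    hW2c hW2g hrep2 hmem2 hmem2
  have hA12 := inner_rectTubeTransferOperator_reproducingState_left ρ J (Ls := Ls) (continuous_fundamentalRep (Fin 2))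
    hW2c hW2g hrep2 hmem1 hmem2
  -- `∫ W2 = 0` (the chain at `β = 0`)
  have hW2int : ∫ b, (fun _ => (1 : ℝ)) b * W2 b ∂(rectSliceMeasure (Matrix.specialUnitaryGroup (Fin 2) ℂ) Ls) = 0 := by
    set d1 : Fin 4 → Matrix.specialUnitaryGroup (Fin 2) ℂ := ![1, 1, 1, 1] with hd1
    have h4 : ∀ b : RectSlice Ls (Matrix.specialUnitaryGroup (Fin 2) ℂ), W2 b =
        (U ℝ ((1 : ℕ) : ℤ)).eval (su2a0 ((List.ofFn fun t : Fin 4 => b (ℓ t) ^ sg t * d1 t).prod)) := by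
      intro b
      simp only [hW2, hplaq, hℓ, hsg, hd1, List.ofFn_succ, List.ofFn_zero, List.prod_cons, List.prod_nil,
        Matrix.cons_val_zero, Matrix.cons_val_succ, zpow_one, zpow_neg, mul_one, mul_assoc]
    have hq0 : (besselI 1 0 - besselI (1 + 2) 0) / ((1 : ℕ) + 1 : ℝ) = 0 := by
      rw [besselI_eq_latticeModels_besselI, besselI_eq_latticeModels_besselI,
        Literature.Probability.LatticeModels.besselI_zero_right, Literature.Probability.LatticeModels.besselI_zero_right]
      norm_num
    have h := su2_integral_prod_exp_mul_chebyshevU_rectSignedLine (Ls := Ls) le_rfl 1 ℓ hℓinj hsg1 d1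
    rw [hq0] at h
    have h5 : ∀ b : RectSlice Ls (Matrix.specialUnitaryGroup (Fin 2) ℂ), (fun _ => (1 : ℝ)) b * W2 b =
        (∏ e : RectTorusSite Ls × Fin k, Real.exp (0 * su2a0 (b e))) *
          (U ℝ ((1 : ℕ) : ℤ)).eval (su2a0 ((List.ofFn fun t : Fin 4 => b (ℓ t) ^ sg t * d1 t).prod)) := by
      intro b
      rw [h4 b]
      simp
    simp_rw [h5]
    rw [h]
    simp
  have hcross : @inner ℝ _ _ (hmem1.toLp _) (rectTubeTransferOperator ρ J Ls (hmem2.toLp _)) = 0 := by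
    rw [hA12, hW2int, mul_zero]
  -- positivity and sizes of the constants
  have hc0pos : 0 < c0 := by
    rw [← hc0int]
    exact integral_exp_pos ((Real.continuous_exp.comp (continuous_const.mul continuous_su2a0)).integrable_of_hasCompactSupport
      (HasCompactSupport.of_compactSpace _))
  have hq2pos : 0 < q2 := by
    rw [hq2, besselISub_div_succ hβ.ne' 1]
    exact div_pos (mul_pos two_pos (hIpos (1 + 1))) hβ
  have hq2le : q2 ≤ c0 := besselISub_div_succ_antitone hβ (Nat.zero_le 1)
  have hC2pos : 0 < C2 := mul_pos (pow_pos hc0pos _) (pow_pos hq2pos _)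
  have hLN : 4 ≤ N := by
    have h := Fintype.card_le_of_injective _ hℓinj
    rwa [Fintype.card_fin] at h
  have hC2le : C2 ≤ c0 ^ N := by
    calc C2 = c0 ^ (N - 4) * q2 ^ 4 := rfl
      _ ≤ c0 ^ (N - 4) * c0 ^ 4 :=
          mul_le_mul_of_nonneg_left (pow_le_pow_left₀ hq2pos.le hq2le _) (pow_nonneg hc0pos.le _)
      _ = c0 ^ N := by rw [← pow_add, Nat.sub_add_cancel hLN]
  -- norms: `‖f_i‖² ≤ e^{βP} ∫ W_i²`
  have hJP : |J| * ((2 : ℕ) * ((Fintype.card (RectTorusSite Ls) : ℝ) *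
      (Fintype.card {p : Fin k × Fin k // p.1 < p.2} : ℝ))) = β * P := by
    rw [hJ, abs_of_pos (half_pos hβ)]; push_cast; ring
  have hm0sq : ∀ b, m0 b ^ 2 ≤ Real.exp (β * P) := by
    intro b
    rw [hm0, ← Real.exp_nat_mul]
    have h2 : ((2 : ℕ) : ℝ) * -(J / 2 * rectMagSum (Ls := Ls) ρ b) = -(J * rectMagSum (Ls := Ls) ρ b) := by
      push_cast; ring
    rw [h2, ← hJP]
    exact exp_neg_rectMagSum_le ρ J fundamentalRep_mem_unitaryGroup b
  have hnorm_le : ∀ {W : RectSlice Ls (Matrix.specialUnitaryGroup (Fin 2) ℂ) → ℝ} (hWc' : Continuous W)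
      (hmemW : MemLp (fun b => m0 b * W b) 2 (rectSliceMeasure (Matrix.specialUnitaryGroup (Fin 2) ℂ) Ls)),
      ‖hmemW.toLp _‖ ^ 2 ≤ Real.exp (β * P) * ∫ b, W b * W b ∂(rectSliceMeasure (Matrix.specialUnitaryGroup (Fin 2) ℂ) Ls) := by
    intro W hWc' hmemW
    have hW2i : Integrable (fun b => W b * W b) (rectSliceMeasure (Matrix.specialUnitaryGroup (Fin 2) ℂ) Ls) :=
      (hWc'.mul hWc').integrable_of_hasCompactSupport (HasCompactSupport.of_compactSpace _)
    rw [norm_sq_eq_integral_sq, ← integral_const_mul]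
    refine integral_mono_ae ((Lp.memLp (hmemW.toLp _)).integrable_sq) (hW2i.const_mul _) ?_
    filter_upwards [hmemW.coeFn_toLp] with b hb
    rw [hb, mul_pow, sq (W b)]
    exact mul_le_mul_of_nonneg_right (hm0sq b) (mul_self_nonneg _)
  -- apply the two-state bound with `m = e^{−βP} C2`
  have hP01 : rectTubeFluxProjection su2MinusOne Ls 0 (hmem1.toLp _) = hmem1.toLp _ := by
    have heig : ∀ s : Fin k → ZMod 2, rectFluxTwistOp Ls su2MinusOne s (hmem1.toLp _) = hmem1.toLp _ := by
      intro s
      have h := rectFluxTwistOp_toLp_eq_smul su2MinusOne s hmem1 1 fun b => by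
        simp only [hm0]; rw [rectMagSum_fluxTwist ρ su2MinusOne_mem_center]; ring
      rwa [one_smul] at h
    rw [rectTubeFluxProjection_apply_of_invariant su2MinusOne heig, if_pos rfl]
  have hP02 : rectTubeFluxProjection su2MinusOne Ls 0 (hmem2.toLp _) = hmem2.toLp _ := by
    have heig : ∀ s : Fin k → ZMod 2, rectFluxTwistOp Ls su2MinusOne s (hmem2.toLp _) = hmem2.toLp _ := by
      intro s
      have h := rectFluxTwistOp_toLp_eq_smul su2MinusOne s hmem2 1 fun b => by
        simp only [hm0]; rw [rectMagSum_fluxTwist ρ su2MinusOne_mem_center, hW2s]; ring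
      rwa [one_smul] at h
    rw [rectTubeFluxProjection_apply_of_invariant su2MinusOne heig, if_pos rfl]
  have hφf1 : @inner ℝ _ _ φ₀ (hmem1.toLp _) ≠ 0 := by
    refine ne_of_gt ?_
    rw [inner_eq_integral]
    refine integral_pos_of_ae_pos (integrable_mul φ₀ (hmem1.toLp _)) ?_
    unfold IsStrictlyPositiveFun at hpos
    filter_upwards [hpos, hmem1.coeFn_toLp] with b hb h1b
    rw [h1b]
    exact mul_pos hb (mul_pos (Real.exp_pos _) one_pos)
  have hA1' : Real.exp (-(β * P)) * C2 * ‖hmem1.toLp _‖ ^ 2 ≤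
      @inner ℝ _ _ (hmem1.toLp _) (rectTubeTransferOperator ρ J Ls (hmem1.toLp _)) := by
    rw [hA1]
    have hn := hnorm_le continuous_const hmem1
    have hint1 : ∫ b, (fun _ => (1 : ℝ)) b * (fun _ => (1 : ℝ)) b
        ∂(rectSliceMeasure (Matrix.specialUnitaryGroup (Fin 2) ℂ) Ls) = 1 := by simp
    rw [hint1] at hn ⊢
    rw [mul_one]
    have hee : Real.exp (-(β * P)) * Real.exp (β * P) = 1 := by
      rw [← Real.exp_add, neg_add_cancel, Real.exp_zero]
    calc Real.exp (-(β * P)) * C2 * ‖hmem1.toLp _‖ ^ 2 ≤ Real.exp (-(β * P)) * C2 * (Real.exp (β * P) * 1) :=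
          mul_le_mul_of_nonneg_left hn (mul_nonneg (Real.exp_pos _).le hC2pos.le)
      _ = (Real.exp (-(β * P)) * Real.exp (β * P)) * C2 := by ring
      _ = C2 := by rw [hee, one_mul]
      _ ≤ c0 ^ N := hC2le
  have hA2' : Real.exp (-(β * P)) * C2 * ‖hmem2.toLp _‖ ^ 2 ≤
      @inner ℝ _ _ (hmem2.toLp _) (rectTubeTransferOperator ρ J Ls (hmem2.toLp _)) := by
    rw [hA2]
    have hn := hnorm_le hW2c hmem2
    calc Real.exp (-(β * P)) * C2 * ‖hmem2.toLp _‖ ^ 2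
        ≤ Real.exp (-(β * P)) * C2 * (Real.exp (β * P) * ∫ b, W2 b * W2 b
            ∂(rectSliceMeasure (Matrix.specialUnitaryGroup (Fin 2) ℂ) Ls)) :=
          mul_le_mul_of_nonneg_left hn (mul_nonneg (Real.exp_pos _).le hC2pos.le)
      _ = (Real.exp (-(β * P)) * Real.exp (β * P)) * (C2 * ∫ b, W2 b * W2 b
            ∂(rectSliceMeasure (Matrix.specialUnitaryGroup (Fin 2) ℂ) Ls)) := by ring
      _ = C2 * ∫ b, W2 b * W2 b ∂(rectSliceMeasure (Matrix.specialUnitaryGroup (Fin 2) ℂ) Ls) := by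
          rw [← Real.exp_add, neg_add_cancel, Real.exp_zero, one_mul]
  have hA2pos : 0 < @inner ℝ _ _ (hmem2.toLp _) (rectTubeTransferOperator ρ J Ls (hmem2.toLp _)) := by
    rw [hA2]
    refine mul_pos hC2pos ?_
    have h3 : W2 1 = 2 := by
      simp only [hW2, hplaq, Pi.one_apply, inv_one, mul_one]
      have : su2a0 (1 : Matrix.specialUnitaryGroup (Fin 2) ℂ) = 1 := by
        unfold su2a0; simp [Matrix.trace_one]
      rw [this]
      have h := U_eval_one (R := ℝ) ((1 : ℕ) : ℤ)
      push_cast at h ⊢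
      linarith [h]
    refine Continuous.integral_pos_of_hasCompactSupport_nonneg_nonzero (x := 1) (hW2c.mul hW2c)
      (HasCompactSupport.of_compactSpace _) (fun b => mul_self_nonneg _) ?_
    rw [h3]; norm_num
  have htwo := rectTubeExcitedNorm_ge_half_of_two_states ρ J (Ls := Ls) (continuous_fundamentalRep (Fin 2))
    fundamentalRep_mem_unitaryGroup hvac hP01 hP02 hφf1 hcross (mul_nonneg (Real.exp_pos _).le hC2pos.le) hA1' hA2' hA2pos
  unfold su2RectExcitedNorm
  rw [show (β * ((Fintype.card (RectTorusSite Ls) : ℝ) * (Fintype.card {p : Fin k × Fin k // p.1 < p.2} : ℝ))) = β * P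
    by rw [hP]]
  calc Real.exp (-(β * P)) * (c0 ^ (N - 4) * q2 ^ 4) / 2 = Real.exp (-(β * P)) * C2 / 2 := by rw [hC2]
    _ ≤ rectTubeExcitedNorm ρ su2MinusOne J Ls := htwo

/-- **THE GLUEBALL CEILING FOR `m′`.**  On every rectangular `SU(2)` tube with two sides `Ls μ, Ls ν ≥ 2` (`μ ≠ ν`) and
every `β > 0`: `su2RectMassGapPrime β Ls ≤ 4·(−log(I₂(β)/I₁(β))) + 2β·(#sites·k(k−1)/2) + log 2` — the `e = 0` gap never
exceeds the one-plaquette scale `4(−ln u)` by more than `2β` per plaquette and `log 2`.  A consistency ceiling; finite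
volume only. [cite: MontvayMunster1994, §3.2.6] -/
theorem su2RectMassGapPrime_le_plaquette {β : ℝ} (hβ : 0 < β) (Ls : Fin k → ℕ) [∀ i, NeZero (Ls i)] {μ ν : Fin k}
    (hμν : μ ≠ ν) (hμ : 2 ≤ Ls μ) (hν : 2 ≤ Ls ν) :
    su2RectMassGapPrime β Ls ≤
      4 * (-Real.log (besselI 2 β / besselI 1 β)) +
        2 * β * (Fintype.card (RectTorusSite Ls) * Fintype.card {p : Fin k × Fin k // p.1 < p.2}) + Real.log 2 := by
  haveI : SecondCountableTopology (Matrix.specialUnitaryGroup (Fin 2) ℂ) := secondCountableTopology_su2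
  set P : ℝ := (Fintype.card (RectTorusSite Ls) : ℝ) * (Fintype.card {p : Fin k × Fin k // p.1 < p.2} : ℝ) with hP
  set N : ℕ := Fintype.card (RectTorusSite Ls × Fin k) with hN
  set c0 : ℝ := (besselI 0 β - besselI (0 + 2) β) / ((0 : ℕ) + 1) with hc0
  set q2 : ℝ := (besselI 1 β - besselI (1 + 2) β) / ((1 : ℕ) + 1) with hq2
  have hIpos : ∀ n : ℕ, 0 < besselI n β := fun n => by
    rw [besselI_eq_latticeModels_besselI]; exact Literature.Probability.LatticeModels.besselI_pos hβ _
  have hc0pos : 0 < c0 := by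
    rw [hc0, besselISub_div_succ hβ.ne' 0]
    exact div_pos (mul_pos two_pos (hIpos (0 + 1))) hβ
  have hq2pos : 0 < q2 := by
    rw [hq2, besselISub_div_succ hβ.ne' 1]
    exact div_pos (mul_pos two_pos (hIpos (1 + 1))) hβ
  have hLN : 4 ≤ N := by
    have h := Fintype.card_le_of_injective _ (rectPlaquetteLinks_injective (Ls := Ls) hμν hμ hν 0)
    rwa [Fintype.card_fin] at h
  have hc0' : (∫ g : Matrix.specialUnitaryGroup (Fin 2) ℂ, Real.exp (β / 2 * ((fundamentalRep (Fin 2) g).trace).re)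
      ∂haarProbability (Matrix.specialUnitaryGroup (Fin 2) ℂ)) = c0 := by
    rw [hc0, ← su2_integral_exp_su2a0_eq hβ.le]
    exact integral_congr_ae (Eventually.of_forall fun U => by simp only [su2_weight_eq]; ring_nf)
  have hJ : |β / 2| * ((2 : ℕ) * ((Fintype.card (RectTorusSite Ls) : ℝ) *
      (Fintype.card {p : Fin k × Fin k // p.1 < p.2} : ℝ))) = β * P := by
    rw [abs_of_pos (half_pos hβ)]; push_cast; ring
  have hTle : ‖rectTubeTransferOperator (fundamentalRep (Fin 2)) (β / 2) Ls‖ ≤ Real.exp (β * P) * c0 ^ N := by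
    have h := norm_rectTubeTransferOperator_le (fundamentalRep (Fin 2)) (β / 2) (Ls := Ls)
      (continuous_fundamentalRep (Fin 2)) fundamentalRep_mem_unitaryGroup
    rwa [hc0', hJ] at h
  have hTpos : 0 < ‖rectTubeTransferOperator (fundamentalRep (Fin 2)) (β / 2) Ls‖ :=
    norm_rectTubeTransferOperator_pos (β / 2) Ls (continuous_fundamentalRep (Fin 2))
  have hEge : Real.exp (-(β * P)) * (c0 ^ (N - 4) * q2 ^ 4) / 2 ≤ su2RectExcitedNorm β Ls := by
    have h := su2_rectExcitedNorm_ge_plaquette hβ Ls hμν hμ hν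
    rwa [show (β * ((Fintype.card (RectTorusSite Ls) : ℝ) * (Fintype.card {p : Fin k × Fin k // p.1 < p.2} : ℝ))) = β * P
      by rw [hP]] at h
  have hlowpos : 0 < Real.exp (-(β * P)) * (c0 ^ (N - 4) * q2 ^ 4) / 2 := by positivity
  have hEpos : 0 < su2RectExcitedNorm β Ls := lt_of_lt_of_le hlowpos hEge
  have h1 : Real.log ‖rectTubeTransferOperator (fundamentalRep (Fin 2)) (β / 2) Ls‖ ≤ β * P + (N : ℝ) * Real.log c0 := by
    have h := Real.log_le_log hTpos hTle
    rwa [Real.log_mul (Real.exp_pos _).ne' (pow_pos hc0pos _).ne', Real.log_exp, Real.log_pow] at h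
  have h2 : -(β * P) + (((N - 4 : ℕ) : ℝ) * Real.log c0 + ((4 : ℕ) : ℝ) * Real.log q2) - Real.log 2 ≤
      Real.log (su2RectExcitedNorm β Ls) := by
    have h := Real.log_le_log hlowpos hEge
    rwa [Real.log_div (mul_pos (Real.exp_pos _) (mul_pos (pow_pos hc0pos _) (pow_pos hq2pos _))).ne' two_ne_zero,
      Real.log_mul (Real.exp_pos _).ne' (mul_pos (pow_pos hc0pos _) (pow_pos hq2pos _)).ne', Real.log_exp,
      Real.log_mul (pow_pos hc0pos _).ne' (pow_pos hq2pos _).ne', Real.log_pow, Real.log_pow] at h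
  have hcast : (((N - 4 : ℕ) : ℝ)) = (N : ℝ) - ((4 : ℕ) : ℝ) := by rw [Nat.cast_sub hLN]
  rw [hcast] at h2
  push_cast at h2
  have key : Real.log c0 - Real.log q2 = -Real.log (besselI 2 β / besselI 1 β) := by
    rw [← Real.log_div hc0pos.ne' hq2pos.ne', ← Real.log_inv]
    congr 1
    rw [hc0, hq2, besselISub_div_succ hβ.ne' 0, besselISub_div_succ hβ.ne' 1]
    have hI1 : besselI (0 + 1) β ≠ 0 := (hIpos (0 + 1)).ne'; have hI2 : besselI (1 + 1) β ≠ 0 := (hIpos (1 + 1)).ne'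
    field_simp
  rw [su2RectMassGapPrime_eq]
  have h3 : (4 : ℝ) * (-Real.log (besselI 2 β / besselI 1 β)) = 4 * Real.log c0 - 4 * Real.log q2 := by rw [← key]; ring
  rw [h3]
  linarith [h1, h2]


/-- The same ceiling with the table's `u(β) = su2CharacterRatio β = I₂(β)/I₁(β)`:
`su2RectMassGapPrime β Ls ≤ 4·(−log u(β)) + 2β·#P + log 2`. [cite: MontvayMunster1994, §3.2.6] -/
theorem su2RectMassGapPrime_le_plaquette' {β : ℝ} (hβ : 0 < β) (Ls : Fin k → ℕ) [∀ i, NeZero (Ls i)] {μ ν : Fin k}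
    (hμν : μ ≠ ν) (hμ : 2 ≤ Ls μ) (hν : 2 ≤ Ls ν) :
    su2RectMassGapPrime β Ls ≤
      4 * (-Real.log (su2CharacterRatio β)) +
        2 * β * (Fintype.card (RectTorusSite Ls) * Fintype.card {p : Fin k × Fin k // p.1 < p.2}) + Real.log 2 := by
  have h := su2RectMassGapPrime_le_plaquette hβ Ls hμν hμ hν
  unfold su2CharacterRatio
  rwa [onePlaquetteExpectSU2_cos_eq_besselI_div]

end SU2

end Summit.Ventures.YMGap.FlowData
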